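import Summits.BirchSwinnertonDyer.BirchSwinnertonDyer.Theorems.TwoAdicConverseOrdLambdaHalfAtTwoThetaDatumDefs
import Summits.BirchSwinnertonDyer.Rank1Residual.TwoVariableGreenbergMainConjectureAnyRoot
import Literature.NumberTheory.EllipticCurves.YanZhu2026.GreenbergLFunctionCoordFree
import HarnessLib

/-!
# Route `TwoAdicConverse` (rung S3), crux `OrdLambdaHalfAtTwo` (stmt-BirchSwinnertonDyer-19556), line
# `kato-determinant-greenberg-two`: the two NAMED RESEARCH RESIDUALS behind the conjecture-grade stub 6‴
# (`ThetaShapiroGreenbergDivisibilityAtTwo`), TYPED — P10 v3 O1 `SplitTwoExplicitReciprocityLawBDP`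
# (stmt-BirchSwinnertonDyer-24727) and O2 `BDPSelmerLowerDivisibilityAtTwo` (stmt-BirchSwinnertonDyer-24728)

Pen `bsd-2adic-plan` GEN 32 DRAFT for the named worker (conv-1 / LEAD 19556 lineage) to land; director-bsd (391)(a).
HONEST FRAMING (cell bsd-2adic): nothing here is proved about any curve; two `@[conjecture]` displayed binders
(research grade, NOT in print at `p = 2`), one coordinate-free receptacle predicate, one kernel seam; no named fact
is minted; BSD is not proved by any of this; `OrdLambdaHalfAtTwo` stays OPEN.

## The index-two phenomenon at a split `2` (why the tree's two-variable frames are not used verbatim)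

For `K` imaginary quadratic with `2 = 𝔭𝔭̄` split, `h_K` odd and `𝓞_K^× = {±1}` (e.g. `K = ℚ(√−7)`), class field
theory gives `Γ_K := Gal(K̃/K) = Gal(M/K)/tors ≅ (ℤ₂^×/±1)_𝔭 × (ℤ₂^×/±1)_𝔭̄` with complex conjugation SWAPPING the
factors: `Γ_K ≅ ℤ₂[C₂]` is the REGULAR module, not `ℤ₂(+) ⊕ ℤ₂(−)` (at odd `p` the two agree since `2 ∈ ℤ_p^×`).
Hence the joint map `(κ_cyc, κ_anti) : Γ_K → ℤ₂²` has image of index `2`, the cyclotomic and anticyclotomic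
`ℤ₂`-extensions share their first layer (`K(√2)` for `K = ℚ(√−7)`, whose three quadratic subextensions inside `K̃`
are `K(√2), K(√−π), K(√−π̄)`, the last two swapped by `τ`), and NO pair `(γ₁, γ₂)` satisfies
`ZpExtension.IsTopGeneratorPair κ_cyc κ_anti γ₁ γ₂`.  Consequences for typing at `p = 2`: (i) every statement with
the binders `[Fact (IsTopGeneratorPair κ₁ κ₂ γ₁ γ₂)] … κ₁.IsCyclotomic → κ₂.IsAnticyclotomic →` is VACUOUS at such
`(K, 2)`; (ii) the value frames `IsGreenbergLFunctionAnyRoot₂` (Yan–Zhu Def. 3.11: the Katz factor `𝓛_𝔭(K)(ξ^{1−τ})`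
read at `(0, r(γ₂)² − 1)`, i.e. `(γ⁺)^{1−τ} = 1`, `(γ⁻)^{1−τ} = (γ⁻)²`) and `CastellaGrossiSkinner2025.IsGreenbergLFunction`
(`oneMinusTauImage`) are (cyc, anti)-WIRED and have no faithful reading in any adapted coordinates at `2`.
REMEDY used here: quantify over an ARBITRARY adapted pair `(κ₁, κ₂; γ₁, γ₂)` (these exist at `2`: e.g.
`(κ_cyc, κ_𝔭)`, `(κ_𝔭, κ_𝔭̄)`) and read the Katz factor COORDINATE-FREELY at the avatar point of the Hecke character
`ξ / ξ^τ` itself (`IsGreenbergLFunctionFree₂`), which in (cyc, anti)-adapted coordinates at odd `p` is the point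
`(0, r(γ₂)² − 1)` of Yan–Zhu (their Def. 3.11 sentence `𝓛_𝔭(K)'(ξ) = 𝓛_𝔭(K)(ξ^{1−τ})`, file
`YanZhu2026/GreenbergMainTheorems` module docstring (T2)).  The Selmer carrier `XGr₂` and the Katz frame
`IsKatzMeasure₂` are already pair-generic.

## What is here

The frame `YanZhu2026.IsGreenbergLFunctionFree₂` (Literature, Yan–Zhu Def. 3.11 coordinate-free: the Katz factor read at
the avatar of `ξ/ξ^τ`; a predicate, nothing asserted) is imported.  §1 `GreenbergLowerInclusionAt W K` — the
datum-level body of O2: Katz–Greenberg frame EXISTS at `(E, K, 2)` for every adapted pair, `X_Gr(E/K̃_∞)` is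
`Λ_K`-torsion and `ch_{Λ_K}(X_Gr)·Λ_K^ur ⊆ (𝓛_2^Gr(E/K))` along every structure-compatible `J` (the FIRST inclusion of
Yan–Zhu Thm. 4.2 (2) = the Eisenstein/Wan LOWER bound on Selmer, `𝓛 ∣ ch X`; the (Im)-equality is not asked).
§2 `ThetaDivisibilityAt W K` — the body of 6‴ at a fixed `(W, K)` (binder-for-binder the registered 6‴).
§3 the two displayed binders: O2 `BDPSelmerLowerDivisibilityAtTwo := ∀ (W, K) in the habitat of 6‴, GreenbergLowerInclusionAt W K`;
O1 `SplitTwoExplicitReciprocityLawBDP := ∀ (W, K) in the habitat, GreenbergLowerInclusionAt W K → ThetaDivisibilityAt W K`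
(the explicit-reciprocity-law / two-variable-zeta-element TRANSFER Greenberg ⟹ ordinary — Yan–Zhu Thm. 4.7 (ii)⇒(i),
BCS Thm. 4.1.3, BSTW Prop. 9.18 lower halves — followed by the specialisation of `Λ_K`-characteristic ideals to the
cyclotomic line, Greenberg control `K̃_∞ → K^cyc_∞`, Shapiro and the comparison `𝓛^PR|_cyc ∼ L₂(E)·L₂(E^K)`, all at
`p = 2` on the residually REDUCIBLE branch (β): in print only for `p` odd with (irr_K)).  §4 the kernel seam
`thetaShapiroGreenbergDivisibilityAtTwo_of_bdp : O1 → O2 → 6‴` (binder shuffling, no content) — so a LINE skeleton may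
register O1, O2 as named stubs and DERIVE 6‴, or keep 6‴ and cite O1/O2 as its research content by name.

JUNK LEDGER.  O2 is an `∃`-statement over GENUINE carriers (`XGr₂`, `XGr₂.charIdeal`, `IsKatzMeasure₂`): false — not
vacuous — if no Katz/Greenberg frame exists at `2`; its frame predicates pin `LK`, `G` only through their interpolation
ranges (same standard as the vetted `GreenbergTwoVariableMainConjectureAnyRootAt`, whose shape §1 copies with `=`
weakened to `≤` and `p := 2`); no (cyc, anti) clause, so not vacuous by the index-two phenomenon; adapted pairs exist.
O1 is an implication whose hypothesis is O2's body at the same `(W, K)`: vacuously true exactly where O2's body fails,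
and there O1 carries no content — the pair (O1, O2) is a BRIDGE split of 6‴ in the sense of planner BC2 (O2 substantive
and open; O2 alone does not give 6‴).  Neither binder mentions `θ`, keyings or `λ` choices beyond 6‴'s own.

References: Yan–Zhu, arXiv:2412.20078v4, Def. 3.11, Thm. 3.9, Thm. 4.2 (2), Thm. 4.7 [YanZhu2024MainConjNonCM];
Burungale–Castella–Skinner, arXiv:2405.00270v2 §1.1, Conj. 4.1.2, Thm. 4.1.3 [BurungaleCastellaSkinner2025];
Burungale–Skinner–Tian–Wan, arXiv:2409.01350 §1.2.1, §9.3.2, Prop. 9.18 [BurungaleSkinnerTianWan2024];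
Castella–Grossi–Skinner, Def. 2.4.3, Thm. 2.4.2, Prop. 3.2.1 [CastellaGrossiSkinner2025]; de Shalit, *Iwasawa theory and
p-adic L-functions of CM elliptic curves* II.4.16–4.17 [deShalit1987]; Washington GTM 83 Thm. 13.4 [Washington1997]
(the rank/torsion computation behind the index-two remark); cell records: P10 v3 `pub/bsd-2adic/plan/s3-promote-6ter/README.md`,
triage r1-2 GEN 33 sharpen (23b), director-bsd (391).
-/

set_option linter.dupNamespace false
set_option autoImplicit false

noncomputable section

open scoped Classical NumberField
open WeierstrassCurve NumberField IsDedekindDomain Field CategoryTheory Function PowerSeries CongruenceSubgroup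
open Literature.NumberTheory.EllipticCurves Literature.NumberTheory.EllipticCurves.Rank1Residual
open Literature.NumberTheory.EllipticCurves.ModularForms
open Literature.NumberTheory.EllipticCurves.Kato2004 Literature.NumberTheory.EllipticCurves.Kato2004.EulerSystemValues
open Literature.NumberTheory.GaloisRepresentations
open Literature.NumberTheory.EllipticCurves.IwasawaAlgebra₂ Literature.NumberTheory.EllipticCurves.UnrSeries₂
open Literature.NumberTheory.EllipticCurves.GreenbergVatsal2000
open Literature.NumberTheory.EllipticCurves.BurungaleCastellaSkinner2025
open Literature.NumberTheory.EllipticCurves.YanZhu2026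
open Summit.BirchSwinnertonDyer.Rank1Residual.X1.MuLambda (lam)
open Summit.BirchSwinnertonDyer.Rank1Residual.X11b (AcSelmer.bdpData AcSelmer.strictDatum)

namespace Summit.BirchSwinnertonDyer.BirchSwinnertonDyer.Theorems.TwoAdicKatoDeterminant

/-! ## §1 O2 at a datum `(W, K)`: the Greenberg-side lower inclusion at `2` -/

/-- **O2 at `(E, K)`** — for every embedding datum `ι : ℚ̄₂ ≅ ℂ` with induced prime `v ∣ 2` (`v̄ ≠ v` the other one),
every ADAPTED pair `(κ₁, κ₂; γ₁, γ₂)` of `ℤ₂`-extensions of `K` (no cyclotomic/anticyclotomic clause — module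
docstring) and the newform `f` of `E = W`: there are Katz–de Shalit period data `(Ω ≠ 0, δ² = ±d_K, Ω₂ ∈ (R₀)ˣ)`, a
series `LK` which IS `𝓛_𝔭(K)` (`IsKatzMeasure₂` at `(γ₁⁻¹, γ₂⁻¹)`) and a series `G` which IS `𝓛_2^Gr(E/K)`
(`IsGreenbergLFunctionFree₂`), such that `X_Gr(E/K̃_∞) = XGr₂ 2 κ₁ κ₂ v̄ γ₁ γ₂` (unramified at `v̄`, no condition at
`v`) is `Λ_K`-torsion and `ch_{Λ_K}(X_Gr)·𝒪_{ℂ₂}⟦T₁,T₂⟧ ⊆ (G)` along every structure-compatible `J : ℤ₂ → 𝒪_{ℂ₂}`.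
VERBATIM the conclusion of `TwoVariableIMC.GreenbergTwoVariableMainConjectureAnyRootAt` with `p := 2`, `=` weakened
to `≤` (the first inclusion of Yan–Zhu Thm. 4.2 (2): `𝓛 ∣ ch X`, the LOWER bound on Selmer) and the coordinate-free
value frame.  A `Prop`-valued function of `(W, K)`; nothing asserted.
[cite: YanZhu2024MainConjNonCM, Thm. 4.2 (2) first inclusion (arXiv:2412.20078v4 TeX l.932–949) and statement 4.1 (2) (l.923–927)]
[cite: BurungaleCastellaSkinner2025, Conj. 4.1.2 (§3.1, p. 8 of arXiv:2405.00270v2)] -/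
def GreenbergLowerInclusionAt (W : WeierstrassCurve ℚ) [W.IsElliptic] [W.IsGloballyMinimal]
    (K : Type) [Field K] [NumberField K] : Prop :=
  ∀ [IsCMField K] (ι : PadicAlgCl 2 ≃+* ℂ) (v vbar : HeightOneSpectrum (𝓞 K)) (κ₁ κ₂ : ZpExtension K 2)
    (γ₁ γ₂ : absoluteGaloisGroup K) [Fact (ZpExtension.IsTopGeneratorPair κ₁ κ₂ γ₁ γ₂)]
    [NeZero (W.conductorNorm ℤ)] (f : CuspForm (Gamma0 (W.conductorNorm ℤ)) 2),
    ModularForms.IsNewformOf W f → ∀ [NeZero (NumberField.discr K).natAbs],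
    ((2 : ℕ) : 𝓞 K) ∈ v.asIdeal → ((2 : ℕ) : 𝓞 K) ∈ vbar.asIdeal → vbar ≠ v →
    (∀ (w : InfinitePlace K) (k : 𝓞 K), k ∈ v.asIdeal ↔ ‖ι.symm (w.embedding (k : K))‖ < 1) →
    ∃ (Ω δ : ℂ) (Ωp : (unrIntegers 2)ˣ) (LK G : PowerSeries (PowerSeries (PadicComplexInt 2))),
      Ω ≠ 0 ∧ (δ ^ 2 = (NumberField.discr K : ℂ) ∨ δ ^ 2 = -(NumberField.discr K : ℂ)) ∧
      IsKatzMeasure₂ ι v vbar ∅ κ₁ κ₂ γ₁⁻¹ γ₂⁻¹ 1 Ω δ ((Ωp : unrIntegers 2) : ℂ_[2]) LK ∧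
      IsGreenbergLFunctionFree₂ ι v vbar κ₁ κ₂ γ₁⁻¹ γ₂⁻¹ f (NumberField.discr K).natAbs
        (NumberField.classNumber K) LK G ∧
      Module.IsTorsion (IwasawaAlgebra₂ 2) ((W.baseChange K).XGr₂ 2 κ₁ κ₂ vbar γ₁ γ₂) ∧
      ∀ J : ℤ_[2] →+* PadicComplexInt 2,
        (∀ x : ℤ_[2], ((J x : PadicComplexInt 2) : ℂ_[2]) = ((x : ℚ_[2]) : ℂ_[2])) →
        (WeierstrassCurve.XGr₂.charIdeal (W.baseChange K) 2 κ₁ κ₂ vbar γ₁ γ₂).map (toUnr₂ 2 J) ≤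
          Ideal.span {G}

/-! ## §2 6‴ at a datum `(W, K)` -/

/-- **The body of 6‴ (`ThetaShapiroGreenbergDivisibilityAtTwo`) at a fixed curve `W` and field `K`** — binder for
binder the registered 6‴ with `W` and `K` (and `K`'s habitat clause) moved to parameters: for every Θ-Shapiro
Kato–Greenberg datum `S` over `(W, K)`, `S.gD ≤ λ(X_Gr,str(E/K^cyc_∞))`.  Nothing asserted.
[cite: Kato2004Asterisque, Thm 17.4] [cite: GreenbergVatsal2000, §1] -/
def ThetaDivisibilityAt (W : WeierstrassCurve ℚ) [W.IsElliptic] [W.IsGloballyMinimal]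
    (K : Type) [Field K] [NumberField K] : Prop :=
    ∀ (κ : ZpExtension ℚ 2) (γ : absoluteGaloisGroup ℚ),
      κ.IsCyclotomic → ∀ (hγ : κ.IsTopGenerator γ), IsCyclotomicVariable 2 γ → IsOrdinaryAt W 2 →
    ∀ [NeZero (W.conductorNorm ℤ)] (f : CuspForm (CongruenceSubgroup.Gamma0 (W.conductorNorm ℤ)) 2),
      ModularForms.IsNewformOf W f →
    ∀ (D : W.SelmerDualData κ γ) (L₀ : IwasawaAlgebra 2),
      iwasawaToPowerSeries 2 L₀ = padicLFunction f (unitRoot W 2 : ℚ_[2]) →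
    ∀ (A : WeierstrassCurve ℚ) [A.IsElliptic] [A.IsGloballyMinimal] (C : VariableChange ℚ),
      C • A = W.quadraticTwist ((NumberField.discr K : ℤ) : ℚ) → IsOrdinaryAt A 2 →
    ∀ [NeZero (A.conductorNorm ℤ)] (g : CuspForm (CongruenceSubgroup.Gamma0 (A.conductorNorm ℤ)) 2),
      ModularForms.IsNewformOf A g →
    ∀ (DA : A.SelmerDualData κ γ) (L₀' : IwasawaAlgebra 2),
      iwasawaToPowerSeries 2 L₀' = padicLFunction g (unitRoot A 2 : ℚ_[2]) →
    ∀ (w : HeightOneSpectrum (𝓞 K)), ((2 : ℕ) : 𝓞 K) ∈ w.asIdeal →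
    ∀ (κK : ZpExtension K 2) (γK : absoluteGaloisGroup K), κK.IsCyclotomic → κK.IsTopGenerator γK →
    ∀ (DGr : (W.baseChange K).GreenbergStrictSelmerDualData κK γK (AcSelmer.bdpData (MK W K) 2 w))
      (Dfi : (W.baseChange K).GreenbergStrictSelmerDualData κK γK (fineData W K)),
      Module.Finite (IwasawaAlgebra 2) DGr.X ∧ Module.IsTorsion (IwasawaAlgebra 2) DGr.X →
    ∀ [ContinuousSMul ℤ_[2] (W.tateModule 2)] [ContinuousSMul ℤ_[2] (A.tateModule 2)]
      (v : HeightOneSpectrum (𝓞 ℚ)) (γᵥ : absoluteGaloisGroup (v.adicCompletion ℚ))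
      (hsurj : Function.Surjective
        (κ.toContinuousMonoidHom.comp (resGalOfEmb (closureEmb (K := ℚ) (v.adicCompletion ℚ)))))
      (hγᵥ : κ.IsTopGenerator (resGalOfEmb (closureEmb (K := ℚ) (v.adicCompletion ℚ)) γᵥ))
      (I_W : IwasawaH1Data W 2 κ γ) (I_A : IwasawaH1Data A 2 κ γ)
      (J : LocalIwasawaH1Data κ v ((tateRep W 2).toLocal v) γᵥ)
      (J' : LocalIwasawaH1Data κ v (tateLocalOrdinaryRep W 2 v) γᵥ)
      (J_A : LocalIwasawaH1Data κ v ((tateRep A 2).toLocal v) γᵥ)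
      (uA : ((tateRep A 2).toLocal v).toTopRep ⟶ ((tateRep W 2).toLocal v).toTopRep)
      (S : ThetaShapiroKatoGreenbergDatum I_W I_A J J' J_A uA hsurj hγ hγᵥ DGr Dfi L₀ L₀' D.lambda DA.lambda),
      S.gD ≤ lambdaInvariant 2 DGr.X

/-! ## §3 The displayed binders O2 and O1 -/

/-- **O2 `BDPSelmerLowerDivisibilityAtTwo`** (item stmt-BirchSwinnertonDyer-24728, route `TwoAdicConverse`, rank 4;
research grade — NOT in print at `p = 2`): on the habitat of 6‴ — `E/ℚ` non-CM, good ORDINARY at `2`, `E[2]`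
REDUCIBLE (branch (β)), `K` imaginary quadratic with the Heegner hypothesis for `2N` (so `2` splits in `K`) — the
Greenberg-side two-variable main conjecture at `2` in its LOWER direction with its frames: `GreenbergLowerInclusionAt W K`
(§1: Katz measure and `𝓛_2^Gr(E/K)` exist in the coordinate-free frame, `X_Gr(E/K̃_∞)` is `Λ_K`-torsion,
`ch(X_Gr)·Λ_K^ur ⊆ (𝓛_2^Gr)`).  WHY IT MIGHT FAIL: every printed lower inclusion (Wan's `U(3,1)` Eisenstein
congruences, Yan–Zhu Thm. 4.2 (2), CGLS/CGS at Eisenstein primes) needs `p` odd, and the Eisenstein case needs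
`E[p]^ss = 𝔽_p(φ) ⊕ 𝔽_p(ψ)` with `φ|_{G_p} ≠ 1, ω` — at `p = 2` every `𝔽₂^×`-valued character is trivial; the
Katz measure / `𝓛^II` constructions at `2` (de Shalit II.4, Hida–Tilouine, CGS Thm. 2.4.1) are themselves
unrecorded at `2`; `μ`-phenomena at `2` (Greenberg Ex. 5.1) may force `ch(X_Gr) ⊄ (G)` integrally.  A `Prop`;
nothing asserted.
[cite: YanZhu2024MainConjNonCM, Thm. 4.2 (2) (arXiv:2412.20078v4 TeX l.932–949)]
[cite: BurungaleCastellaSkinner2025, Conj. 4.1.2 and Thm. 1.4.1 (arXiv:2405.00270v2)]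
[cite: CastellaGrossiSkinner2025, Thm. 2.4.1, Def. 2.4.3] -/
@[conjecture] def BDPSelmerLowerDivisibilityAtTwo : Prop :=
  ∀ (W : WeierstrassCurve ℚ) [W.IsElliptic] [W.IsGloballyMinimal],
    ¬ W.HasCM → GoodOrd W 2 → ¬ W.HasIrreducibleModPGaloisRep 2 →
    ∀ (K : Type) [Field K] [NumberField K],
      (IsImaginaryQuadratic K ∧ SatisfiesHeegnerHypothesis (2 * W.conductorNorm ℤ) K) →
      GreenbergLowerInclusionAt W K

/-- **O1 `SplitTwoExplicitReciprocityLawBDP`** (item stmt-BirchSwinnertonDyer-24727, route `TwoAdicConverse`, rank 3;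
research grade — NOT in print at `p = 2`), typed in USE-SHAPE as the datum-level BRIDGE «Greenberg two-variable
lower inclusion at `(E, K, 2)` ⟹ 6‴ at `(E, K)`»: `GreenbergLowerInclusionAt W K → ThetaDivisibilityAt W K` on
the habitat of 6‴.  Mathematical content (why the name): the EXPLICIT RECIPROCITY LAWS at the split prime for the
two-variable zeta element (`loc_v̄`/`loc_v` against `𝓛^Gr`, `𝓛^PR`), which transfer the Greenberg lower inclusion
to the ordinary one by the four-term Poitou–Tate sequence (Yan–Zhu Thm. 4.7 (ii)⇒(i) lower halves = BCS Thm. 4.1.3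
= BSTW Prop. 9.18, §9.3.2), followed by specialising `Λ_K`-characteristic ideals to the cyclotomic line, Greenberg
control `K̃_∞ → K^cyc_∞`, Shapiro `X(E/K^cyc_∞) ∼ X(E/ℚ_∞) ⊕ X(E^K/ℚ_∞)` and the interpolation comparison
`𝓛^PR(E/K)|_cyc ∼ L₂(E)·L₂(E^K)` (Rohrlich non-vanishing; the tree's `gD`), at `p = 2` on branch (β).  WHY IT MIGHT
FAIL: the printed transfer needs `p` odd and (irr_K) (`E[p]|_{G_K}` absolutely irreducible) for the freeness /
localisation of `H¹_Iw` and for the ERL at `p`; at `2` with `E[2]` reducible the Iwasawa cohomology has `2`-torsion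
and pseudo-null defects, the ERL constants acquire powers of `2` (the cell's F-27a reading), and control at `2` meets
`μ > 0`; a vacuity caveat: where O2's body fails at `(W, K)` this implication holds emptily and says nothing.
[cite: YanZhu2024MainConjNonCM, Thm. 4.7 (arXiv:2412.20078v4)]
[cite: BurungaleCastellaSkinner2025, Thm. 4.1.3 (arXiv:2405.00270v2 p. 8)]
[cite: BurungaleSkinnerTianWan2024, §9.3.2 and Prop. 9.18 (arXiv:2409.01350)]
[cite: CastellaGrossiSkinner2025, Prop. 3.2.1] -/
@[conjecture] def SplitTwoExplicitReciprocityLawBDP : Prop :=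
  ∀ (W : WeierstrassCurve ℚ) [W.IsElliptic] [W.IsGloballyMinimal],
    ¬ W.HasCM → GoodOrd W 2 → ¬ W.HasIrreducibleModPGaloisRep 2 →
    ∀ (K : Type) [Field K] [NumberField K],
      (IsImaginaryQuadratic K ∧ SatisfiesHeegnerHypothesis (2 * W.conductorNorm ℤ) K) →
      GreenbergLowerInclusionAt W K → ThetaDivisibilityAt W K

/-! ## §4 The kernel seam: O1 → O2 → 6‴ -/

/-- **O1 and O2 give 6‴** (binder shuffling; the `K`-binders of 6‴ commute past the `κ, γ, f, D, L₀` binders, which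
do not mention `K`).  So a LINE skeleton may register O1, O2 as named research stubs and derive
`stub_thetaShapiroGreenbergDivisibilityAtTwo` from them. [folklore] -/
theorem thetaShapiroGreenbergDivisibilityAtTwo_of_bdp (h₁ : SplitTwoExplicitReciprocityLawBDP)
    (h₂ : BDPSelmerLowerDivisibilityAtTwo) : ThetaShapiroGreenbergDivisibilityAtTwo := by
  intro W _ _ hCM hGO hβ κ γ hκ hγ hγ' hord _ f hf D L₀ hL₀ K _ _ hK
  exact h₁ W hCM hGO hβ K hK (h₂ W hCM hGO hβ K hK) κ γ hκ hγ hγ' hord f hf D L₀ hL₀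

/-- Conversely-shaped sanity link: 6‴ itself gives O1 (an implication with 6‴'s body as conclusion) — recorded so
that refuters see at once that O1 is WEAKER than 6‴ and that the content of the pair sits in O2 and in the
transfer. [folklore] -/
theorem splitTwoExplicitReciprocityLawBDP_of_theta (h : ThetaShapiroGreenbergDivisibilityAtTwo) :
    SplitTwoExplicitReciprocityLawBDP := by
  intro W _ _ hCM hGO hβ K _ _ hK _ κ γ hκ hγ hγ' hord _ f hf D L₀ hL₀
  exact h W hCM hGO hβ κ γ hκ hγ hγ' hord f hf D L₀ hL₀ K hK

end Summit.BirchSwinnertonDyer.BirchSwinnertonDyer.Theorems.TwoAdicKatoDeterminant
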